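import Summits.QuantumFields.YangMills.Theorems.AlphaInputsT3ACv3LinearLiftFluxClass
import Summits.QuantumFields.YangMills.Theorems.AlphaInputsT3ACv3LinearLiftFluxCocycle
import Summits.QuantumFields.YangMills.Theorems.AlphaInputsT3ACv3LinearLiftTorusLip
import HarnessLib

/-!
# `AlphaInputsT3ACv3LinearLiftFluxCombine` — «FLUX-COMBINE»: THE FLUX-SECTOR LIFT ASSEMBLED — from the coarse angles `θ` and the integer part `m` of their curl to ONE fine one-form `a`
# with EXACT average `θ − 2π·s` (`s` an integer gauge), a GLOBALLY small smooth part, a constant flux part and INTEGER corner defects at every level — cell `ym3-torus`, width seat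
# `ym-ust-20520-w5` (g8), line «SYM-CENTRE» (EX cure (ii-a)); composes this seat's ✓FLUX-LIFT∕✓FLUX-ROUND∕✓ZCLASS with ★px19 g3's ✓`exists_smoothExactLift_torus`

WHY.  The (R4) assembly (pen ★px6 g3 after ★px20 g2, 23:15Z) needs, for a diagonal coarse field `V′ = gexpAt θ` of the reducible sector, a fine `a` in the fibre with `RegPr`; with FLUX
(`[m] ≠ 0`) the raw curl of `θ` is not small and the recipe of the bus (22:48Z∕23:07Z) must be run: `m` is an antisymmetric integer 2-cocycle (✓`int_cube_of_near_curl`), `m = q·E + curl s`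
(✓`exists_int_class_decomposition₃`), `θ′ := θ − 2πs − 2π·Σ q_{μν}W_{μν}` has small REAL curl, `a := liftL θ′ + 2π·Σ q_{μν} w_{μν}`.  THIS FILE types that glue once, for three
exhausting directions of a general torus: §1 linearity letters; §2 ★`exists_fluxLift_real` (the flux pair with a REAL charge, standard form at EVERY level `s ≤ k`); §3 ★`two_pi_abs_q_le`
(the class is small: `2π|q_{μν}| ≤ N²·φ₀`, by summing `m` over one `(μν)`-slice); §4 ★★★`exists_flux_combine` — the ∃-package the assembler calls.
HONEST FRAMING.  Composition of landed kernel facts; no estimate of [7]∕[4]; nothing of EX∕the crux∕`hSymCentre` proved or claimed; count-neutral helper (`--supports stmt-QuantumFields-19200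
--as helper`); def-free; every landed file untouched.  YM₃ on the torus is a RUNG (R3) of the programme, not the Clay problem; no claim about d = 4, infinite volume or a mass gap.

References: T. Bałaban, Commun. Math. Phys. 109 (1987) 249–301 [Balaban1987RG1] ((0.4)+(0.11) p.253); Commun. Math. Phys. 98 (1985) 17–51 [Balaban1985Averaging] ((9), (14) p.19);
Commun. Math. Phys. 102 (1985) 277–309 [Balaban1985Variational] ((6) p.278).
-/

set_option autoImplicit false

noncomputable section

namespace Summit.QuantumFields.YangMills.Theorems.LinearLiftFlux

open scoped BigOperators
open Finset
open Literature.MathematicalPhysics.QuantumFieldTheory.Balaban1983to89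
open Summit.QuantumFields.YangMills.Theorems.AbelianEML
open Summit.QuantumFields.YangMills.Theorems.LinearLiftSpread (linAvgIter_sub curlAt_sub hN hside)
open Summit.QuantumFields.YangMills.Theorems.LinearLiftSpreadLip (exists_smoothExactLift_torus)

variable {P : Params} {j : ℕ}

/-! ## §1 Linearity letters -/

/-- The iterated linear average is additive. [cite: Balaban1987RG1, (0.11) p.253] -/
theorem linAvgIter_add' (s : ℕ) (a b : PBond P 0 → ℝ) : linAvgIter s (fun c => a c + b c) = fun c => linAvgIter s a c + linAvgIter s b c := by
  have h := linAvgIter_sub (fun c => a c + b c) b s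
  have e : ((fun c => a c + b c) - b : PBond P 0 → ℝ) = a := by funext c; simp
  rw [e] at h
  funext c
  have hc := congrFun h c
  simp only [Pi.sub_apply] at hc
  linarith

/-- The lattice curl is additive. [folklore] -/
theorem curlAt_add' (a b : PBond P j → ℝ) (x : Site P j) (μ ν : Fin P.d) :
    curlAt (fun c => a c + b c) x μ ν = curlAt a x μ ν + curlAt b x μ ν := by
  simp only [curlAt]; ring

/-- The lattice curl of a real multiple. [folklore] -/
theorem curlAt_const_mul (r : ℝ) (a : PBond P j → ℝ) (x : Site P j) (μ ν : Fin P.d) : curlAt (fun c => r * a c) x μ ν = r * curlAt a x μ ν := by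
  simp only [curlAt]; ring

/-! ## §2 The flux pair with a real charge, at every level -/

/-- **★ THE FLUX COCHAIN WITH REAL CHARGE `r`, STANDARD FORM AT EVERY LEVEL `s ≤ k`**: `curl (linAvgIter s w)(x;κλ) = sgn_{κλ}·(r·(L²)^s/M₀² − r·[x_μ = −1 ∧ x_ν = −1])`.
[cite: Balaban1987RG1, (0.4)+(0.11) p.253; Balaban1985Averaging, (9)+(14) p.19] -/
theorem exists_fluxLift_real (k : ℕ) (hk : k ≤ P.m + P.K) {μ ν : Fin P.d} (hμν : μ ≠ ν) (r : ℝ) :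
    ∃ w : PBond P 0 → ℝ, ∀ s, s ≤ k → ∀ (x : Site P s) (κ lam : Fin P.d), curlAt (linAvgIter s w) x κ lam =
      (if κ = μ ∧ lam = ν then (1 : ℝ) else if κ = ν ∧ lam = μ then -1 else 0) *
        (r * (((P.L : ℝ) ^ 2) ^ s * (1 / ((P.sitesPerDir 0 : ℝ)) ^ 2) - (if x μ = -1 ∧ x ν = -1 then 1 else 0))) := by
  obtain ⟨w, hw⟩ := exists_stdFlux_cochain (P := P) hμν r
  refine ⟨w, fun s hs x κ lam => ?_⟩
  have hsk : s ≤ P.m + P.K := hs.trans hk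
  have hmain : curlAt (linAvgIter s w) x μ ν = r * (((P.L : ℝ) ^ 2) ^ s * (1 / ((P.sitesPerDir 0 : ℝ)) ^ 2) - (if x μ = -1 ∧ x ν = -1 then 1 else 0)) :=
    curlAt_linAvgIter_stdFlux hμν w r (1 / ((P.sitesPerDir 0 : ℝ)) ^ 2) (fun y => by rw [hw y μ ν, if_pos ⟨rfl, rfl⟩, one_mul]) s hsk x
  by_cases hκμ : κ = μ
  · subst hκμ
    by_cases hlν : lam = ν
    · subst hlν; rw [if_pos ⟨rfl, rfl⟩, one_mul, hmain]
    · rw [if_neg (fun h => hlν h.2), if_neg (fun h => hμν h.1), zero_mul]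
      by_cases hlμ : lam = κ
      · subst hlμ; exact curlAt_self _ x _
      · exact curlAt_linAvgIter_eq_zero (fun h => hlμ h.symm) w
          (fun y => by rw [hw y κ lam, if_neg (fun h => hlν h.2), if_neg (fun h => hμν h.1), zero_mul]) s hsk x
  · by_cases hκν : κ = ν
    · subst hκν
      rw [if_neg (fun h => hκμ h.1)]
      by_cases hlμ : lam = μ
      · subst hlμ; rw [if_pos ⟨rfl, rfl⟩, curlAt_swap', hmain]; ring
      · rw [if_neg (fun h => hlμ h.2), zero_mul]
        by_cases hlν : lam = κ
        · subst hlν; exact curlAt_self _ x _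
        · exact curlAt_linAvgIter_eq_zero (Ne.symm hlν) w
            (fun y => by rw [hw y κ lam, if_neg (fun h => hκμ h.1), if_neg (fun h => hlμ h.2), zero_mul]) s hsk x
    · rw [if_neg (fun h => hκμ h.1), if_neg (fun h => hκν h.1), zero_mul]
      by_cases hlκ : lam = κ
      · subst hlκ; exact curlAt_self _ x _
      · exact curlAt_linAvgIter_eq_zero (Ne.symm hlκ) w
          (fun y => by rw [hw y κ lam, if_neg (fun h => hκμ h.1), if_neg (fun h => hκν h.1), zero_mul]) s hsk x

/-! ## §3 The class is small: `2π·|q_{μν}| ≤ N²·φ₀` -/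

/-- The site of the `(μν)`-slice through `w` with labels `(t₁, t₂)`. Written with `Function.update` so that `ZMod` translations act by bijections. [folklore] -/
theorem slice_shift_fst (w : Site P j) {μ ν : Fin P.d} (hμν : μ ≠ ν) (t : ZMod (P.sitesPerDir j) × ZMod (P.sitesPerDir j)) :
    Site.shift (Function.update (Function.update w μ t.1) ν t.2 : Site P j) μ = Function.update (Function.update w μ (t.1 + 1)) ν t.2 := by
  funext κ
  by_cases h1 : κ = μ
  · subst h1; rw [Site.shift_apply, if_pos rfl, Function.update_of_ne hμν, Function.update_self, Function.update_of_ne hμν, Function.update_self]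
  · rw [Site.shift_apply, if_neg h1]
    by_cases h2 : κ = ν
    · subst h2; rw [Function.update_self, Function.update_self]
    · rw [Function.update_of_ne h2, Function.update_of_ne h1, Function.update_of_ne h2, Function.update_of_ne h1]

/-- The `ν`-translate of a slice site. [folklore] -/
theorem slice_shift_snd (w : Site P j) {μ ν : Fin P.d} (hμν : μ ≠ ν) (t : ZMod (P.sitesPerDir j) × ZMod (P.sitesPerDir j)) :
    Site.shift (Function.update (Function.update w μ t.1) ν t.2 : Site P j) ν = Function.update (Function.update w μ t.1) ν (t.2 + 1) := by
  funext κ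
  by_cases h2 : κ = ν
  · subst h2; rw [Site.shift_apply, if_pos rfl, Function.update_self, Function.update_self]
  · rw [Site.shift_apply, if_neg h2, Function.update_of_ne h2, Function.update_of_ne h2]

/-- **THE CURL SUMS TO ZERO OVER A COORDINATE 2-SLICE** (each bond value appears once with each sign). [cite: Balaban1985Averaging, (9) p.19] -/
theorem sum_slice_curlAt_eq_zero (θ : PBond P j → ℝ) (w : Site P j) {μ ν : Fin P.d} (hμν : μ ≠ ν) :
    ∑ t : ZMod (P.sitesPerDir j) × ZMod (P.sitesPerDir j), curlAt θ (Function.update (Function.update w μ t.1) ν t.2) μ ν = 0 := by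
  simp only [curlAt]
  rw [Finset.sum_sub_distrib, Finset.sum_sub_distrib, Finset.sum_add_distrib]
  have e1 : ∑ t : ZMod (P.sitesPerDir j) × ZMod (P.sitesPerDir j), θ ⟨Site.shift (Function.update (Function.update w μ t.1) ν t.2 : Site P j) μ, ν⟩
      = ∑ t : ZMod (P.sitesPerDir j) × ZMod (P.sitesPerDir j), θ ⟨Function.update (Function.update w μ t.1) ν t.2, ν⟩ := by
    simp_rw [slice_shift_fst w hμν]
    exact Fintype.sum_equiv ((Equiv.addRight (1 : ZMod (P.sitesPerDir j))).prodCongr (Equiv.refl _)) _ _ (fun t => rfl)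
  have e2 : ∑ t : ZMod (P.sitesPerDir j) × ZMod (P.sitesPerDir j), θ ⟨Site.shift (Function.update (Function.update w μ t.1) ν t.2 : Site P j) ν, μ⟩
      = ∑ t : ZMod (P.sitesPerDir j) × ZMod (P.sitesPerDir j), θ ⟨Function.update (Function.update w μ t.1) ν t.2, μ⟩ := by
    simp_rw [slice_shift_snd w hμν]
    exact Fintype.sum_equiv ((Equiv.refl _).prodCongr (Equiv.addRight (1 : ZMod (P.sitesPerDir j)))) _ _ (fun t => rfl)
  rw [e1, e2]; ring

/-- The standard defect meets a `(μν)`-slice in exactly one site. [folklore] -/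
theorem sum_slice_indicator (w : Site P j) {μ ν : Fin P.d} (hμν : μ ≠ ν) :
    ∑ t : ZMod (P.sitesPerDir j) × ZMod (P.sitesPerDir j),
      (if Function.update (Function.update w μ t.1) ν t.2 μ = -1 ∧ Function.update (Function.update w μ t.1) ν t.2 ν = -1 then (1 : ℝ) else 0) = 1 := by
  have e : ∀ t : ZMod (P.sitesPerDir j) × ZMod (P.sitesPerDir j),
      (if Function.update (Function.update w μ t.1) ν t.2 μ = -1 ∧ Function.update (Function.update w μ t.1) ν t.2 ν = -1 then (1 : ℝ) else 0)
        = if t = ((-1 : ZMod (P.sitesPerDir j)), (-1 : ZMod (P.sitesPerDir j))) then 1 else 0 := by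
    intro t
    rw [Function.update_of_ne hμν, Function.update_self, Function.update_self]
    congr 1
    rw [Prod.ext_iff]
  simp_rw [e]
  rw [Finset.sum_ite_eq']; simp

/-- **★ THE CLASS IS SMALL**: if `|curl θ − 2π·m| ≤ φ₀` pointwise and `m = q·E + curl s` on the `(μν)`-components (`μ ≠ ν`), then `2π·|q_{μν}| ≤ N²·φ₀` (`N` = sites per direction):
sum `m` over one `(μν)`-slice — the curls drop out, the defect contributes `q` once, each of the `N²` terms is within `φ₀/2π` of a curl. [cite: Balaban1985Averaging, (9)+(14) p.19] -/
theorem two_pi_abs_q_le (θ : PBond P j → ℝ) (m : Site P j → Fin P.d → Fin P.d → ℤ) {φ₀ : ℝ} (hnear : ∀ (y : Site P j) (μ ν : Fin P.d), |curlAt θ y μ ν - 2 * Real.pi * m y μ ν| ≤ φ₀)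
    {μ ν : Fin P.d} (hμν : μ ≠ ν) (q : ℤ) (s : PBond P j → ℤ)
    (hdec : ∀ y, (m y μ ν : ℝ) = q * (if y μ = -1 ∧ y ν = -1 then 1 else 0) + ((s ⟨y, μ⟩ : ℝ) + s ⟨y.shift μ, ν⟩ - s ⟨y.shift ν, μ⟩ - s ⟨y, ν⟩)) :
    2 * Real.pi * |(q : ℝ)| ≤ ((P.sitesPerDir j : ℝ)) ^ 2 * φ₀ := by
  set w : Site P j := fun _ => 0
  set pt : ZMod (P.sitesPerDir j) × ZMod (P.sitesPerDir j) → Site P j := fun t => Function.update (Function.update w μ t.1) ν t.2 with hpt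
  -- the integer cochain `s` read as a real one-form
  set sR : PBond P j → ℝ := fun b => (s b : ℝ) with hsR
  have hcurl_s : ∀ y, ((s ⟨y, μ⟩ : ℝ) + s ⟨y.shift μ, ν⟩ - s ⟨y.shift ν, μ⟩ - s ⟨y, ν⟩) = curlAt sR y μ ν := fun y => by simp only [curlAt, hsR]
  have hsum_m : ∑ t, (2 * Real.pi * (m (pt t) μ ν : ℝ)) = 2 * Real.pi * q := by
    have e : ∀ t, (2 * Real.pi * (m (pt t) μ ν : ℝ)) = 2 * Real.pi * q * (if pt t μ = -1 ∧ pt t ν = -1 then (1:ℝ) else 0) + 2 * Real.pi * curlAt sR (pt t) μ ν := by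
      intro t; rw [hdec, hcurl_s]; ring
    simp_rw [e]
    rw [Finset.sum_add_distrib, ← Finset.mul_sum, ← Finset.mul_sum, sum_slice_indicator w hμν, sum_slice_curlAt_eq_zero sR w hμν]; ring
  have hsum_θ : ∑ t, curlAt θ (pt t) μ ν = 0 := sum_slice_curlAt_eq_zero θ w hμν
  have hkey : 2 * Real.pi * (q : ℝ) = -∑ t, (curlAt θ (pt t) μ ν - 2 * Real.pi * (m (pt t) μ ν : ℝ)) := by
    rw [Finset.sum_sub_distrib, hsum_θ, hsum_m]; ring
  have hcard : (Fintype.card (ZMod (P.sitesPerDir j) × ZMod (P.sitesPerDir j)) : ℝ) = ((P.sitesPerDir j : ℝ)) ^ 2 := by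
    rw [Fintype.card_prod, ZMod.card]; push_cast; ring
  have hπ := Real.pi_pos
  have h2π : (0 : ℝ) < 2 * Real.pi := by positivity
  calc 2 * Real.pi * |(q : ℝ)| = |2 * Real.pi * (q : ℝ)| := by rw [abs_mul (2 * Real.pi) (q : ℝ), abs_of_pos h2π]
    _ = |∑ t, (curlAt θ (pt t) μ ν - 2 * Real.pi * (m (pt t) μ ν : ℝ))| := by rw [hkey, abs_neg]
    _ ≤ ∑ t, |curlAt θ (pt t) μ ν - 2 * Real.pi * (m (pt t) μ ν : ℝ)| := Finset.abs_sum_le_sum_abs _ _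
    _ ≤ ∑ _t : ZMod (P.sitesPerDir j) × ZMod (P.sitesPerDir j), φ₀ := Finset.sum_le_sum fun t _ => hnear _ _ _
    _ = ((P.sitesPerDir j : ℝ)) ^ 2 * φ₀ := by rw [Finset.sum_const, Finset.card_univ, nsmul_eq_mul, hcard]

end Summit.QuantumFields.YangMills.Theorems.LinearLiftFlux

end
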